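import Summits.AtomisticToContinuum.Crystallization.Theorems.OverbindingBudgetAffineFarFieldCellMove

/-!
# OverbindingBudget (2c) — part 27Vb-A: moment data of DISTORTED cells (affine images) (lens-4 g93; r1659 S3 groundwork)

Support file, pure analysis on `ℝ³ = EuclideanSpace ℝ (Fin 3)`, no atlas; companion of part 27Vb-S
(`…FarFieldCellSymm` + `…FarFieldCellMove`: symmetry and isometric transport).  The cells of the affine
run-cut configuration are affine images
`q + A(K − p)` of the ideal cells with `A` a linear automorphism CLOSE TO an isometry `R` (27Vc supplies
`‖A − R‖ ≤ ε`, `‖A‖ ≤ a`, ε ≈ 10⁻³).  This file transports the typed interface `IsMomentCell` of part 27Va-B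
through such maps, with explicit constants:

* `affMap p q A := x ↦ q + A(x − p)`; `setIntegral_image_affMap` — `∫_{affMap '' K} g = |det A| · ∫_K g ∘ affMap`
  (Mathlib's change of variables `integral_image_eq_integral_abs_det_fderiv_smul`); `volume_image_affMap_toReal`
  — `|affMap '' K| = |det A|·|K|`;
* `abs_sum_two_form_sub_le` — TRACE PERTURBATION: `|Σ_i B(L e_i, L e_i) − Σ_i B(e_i, e_i)| ≤ 3ε(1 + a)‖B‖` when
  `‖L − R‖ ≤ ε`, `‖L‖ ≤ a` (uses `sum_two_form_isometry` of 27Vb-S and `B(u,u) − B(v,v) = B(u−v,u) + B(v,u−v)`);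
* `IsMomentCell.image_affMap` — ★ `IsMomentCell K p σ δ μ₃ μ₄ ⊢ IsMomentCell (affMap p q A '' K) q σ
  (δa² + 3|σ|ε(1+a)) (μ₃a³) (μ₄a⁴)`: the second moment per volume `σ` is UNCHANGED (the determinant cancels
  against the volume), the isotropy defect grows by `3|σ|ε(1+a)`, absolute moments by `a^k`;
* `IsCentrallySymmetric.image_affMap`, `cubic_clause_image_affMap` (`τ ↦ τa³`).

With 27Vb-S this closes the TRANSPORT half of 27Vb: per letter ONE reference cell with its symmetries and
three scalars; per site an isometry `R` (ideal lattice frame) composed with a small distortion `A`.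
-/

namespace Summit.AtomisticToContinuum.Crystallization.Theorems.OverbindingBudgetAffineFarFieldCellAffine

noncomputable section

open MeasureTheory
open Summit.AtomisticToContinuum.Crystallization.Theorems.OverbindingBudgetAffineFarFieldCellTaylor
open Summit.AtomisticToContinuum.Crystallization.Theorems.OverbindingBudgetAffineFarFieldCellSymm
open Summit.AtomisticToContinuum.Crystallization.Theorems.OverbindingBudgetAffineFarFieldCellMove

local notation "E3" => EuclideanSpace ℝ (Fin 3)

/-! ### Bilinear bookkeeping -/

/-- `B(u,u) − B(v,v) = B(u−v, u) + B(v, u−v)` for a bilinear form on the diagonal. -/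
theorem two_form_diag_sub (B : E3 [×2]→L[ℝ] ℝ) (u v : E3) :
    B (fun _ => u) - B (fun _ => v) = B ![u - v, u] + B ![v, u - v] := by
  have t0 : (fun _ : Fin 2 => u) = Function.update ![v, u] 0 u := by
    funext k; fin_cases k <;> simp
  have t1 : (![v, u] : Fin 2 → E3) = Function.update ![v, u] 0 v := by
    funext k; fin_cases k <;> simp
  have t2 : (![u - v, u] : Fin 2 → E3) = Function.update ![v, u] 0 (u - v) := by
    funext k; fin_cases k <;> simp
  have t3 : (fun _ : Fin 2 => v) = Function.update ![v, u] 1 v := by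
    funext k; fin_cases k <;> simp
  have t4 : (![v, u - v] : Fin 2 → E3) = Function.update ![v, u] 1 (u - v) := by
    funext k; fin_cases k <;> simp
  have t5 : (![v, u] : Fin 2 → E3) = Function.update ![v, u] 1 u := by
    funext k; fin_cases k <;> simp
  have e1 : B ![u - v, u] = B (fun _ => u) - B ![v, u] := by
    rw [t2, B.map_update_sub, ← t0, ← t1]
  have e2 : B ![v, u - v] = B ![v, u] - B (fun _ => v) := by
    rw [t4, B.map_update_sub, ← t5, ← t3]
  rw [e1, e2]; ring

/-- `|B(x, y)| ≤ ‖B‖‖x‖‖y‖`. -/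
theorem abs_two_form_le (B : E3 [×2]→L[ℝ] ℝ) (x y : E3) : |B ![x, y]| ≤ ‖B‖ * ‖x‖ * ‖y‖ := by
  have h := B.le_opNorm ![x, y]
  rw [Fin.prod_univ_two] at h
  simp only [Matrix.cons_val_zero, Matrix.cons_val_one] at h
  rw [Real.norm_eq_abs] at h
  linarith [h]

/-- **Trace perturbation.**  If `‖L − R‖ ≤ ε` for a linear isometry `R` and `‖L‖ ≤ a`, then
`|Σ_i B(L e_i, L e_i) − Σ_i B(e_i, e_i)| ≤ 3ε(1 + a)‖B‖`. -/
theorem abs_sum_two_form_sub_le (B : E3 [×2]→L[ℝ] ℝ) (L : E3 →L[ℝ] E3) (R : E3 ≃ₗᵢ[ℝ] E3)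
    {ε a : ℝ} (hε : ‖L - R.toLinearIsometry.toContinuousLinearMap‖ ≤ ε) (ha : ‖L‖ ≤ a) :
    |∑ i : Fin 3, B (fun _ => L (e3 i)) - ∑ i : Fin 3, B (fun _ => e3 i)|
      ≤ 3 * ε * (1 + a) * ‖B‖ := by
  rw [← sum_two_form_isometry B R, ← Finset.sum_sub_distrib]
  have hεnn : 0 ≤ ε := le_trans (norm_nonneg _) hε
  have key : ∀ i : Fin 3,
      |B (fun _ => L (e3 i)) - B (fun _ => R (e3 i))| ≤ ε * (1 + a) * ‖B‖ := by
    intro i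
    have huv : ‖L (e3 i) - R (e3 i)‖ ≤ ε := by
      have e : L (e3 i) - R (e3 i) = (L - R.toLinearIsometry.toContinuousLinearMap) (e3 i) := by
        simp
      rw [e]
      calc _ ≤ ‖L - R.toLinearIsometry.toContinuousLinearMap‖ * ‖e3 i‖ :=
            ContinuousLinearMap.le_opNorm _ _
        _ ≤ ε := by rw [norm_e3, mul_one]; exact hε
    have hu : ‖L (e3 i)‖ ≤ a :=
      calc ‖L (e3 i)‖ ≤ ‖L‖ * ‖e3 i‖ := L.le_opNorm _
        _ ≤ a := by rw [norm_e3, mul_one]; exact ha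
    have hv : ‖R (e3 i)‖ = 1 := by rw [R.norm_map, norm_e3]
    rw [two_form_diag_sub]
    have b1 := abs_two_form_le B (L (e3 i) - R (e3 i)) (L (e3 i))
    have b2 := abs_two_form_le B (R (e3 i)) (L (e3 i) - R (e3 i))
    rw [hv] at b2
    have p1 : ‖L (e3 i) - R (e3 i)‖ * ‖L (e3 i)‖ ≤ ε * a :=
      mul_le_mul huv hu (norm_nonneg _) hεnn
    have p1' : ‖B‖ * ‖L (e3 i) - R (e3 i)‖ * ‖L (e3 i)‖ ≤ ‖B‖ * (ε * a) := by
      rw [mul_assoc]; exact mul_le_mul_of_nonneg_left p1 (norm_nonneg _)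
    have p2' : ‖B‖ * 1 * ‖L (e3 i) - R (e3 i)‖ ≤ ‖B‖ * ε := by
      rw [mul_one]; exact mul_le_mul_of_nonneg_left huv (norm_nonneg _)
    calc _ ≤ |B ![L (e3 i) - R (e3 i), L (e3 i)]| + |B ![R (e3 i), L (e3 i) - R (e3 i)]| :=
          abs_add_le _ _
      _ ≤ ‖B‖ * (ε * a) + ‖B‖ * ε := add_le_add (b1.trans p1') (b2.trans p2')
      _ = ε * (1 + a) * ‖B‖ := by ring
  calc _ ≤ ∑ i : Fin 3, |B (fun _ => L (e3 i)) - B (fun _ => R (e3 i))| :=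
        Finset.abs_sum_le_sum_abs _ _
    _ ≤ ∑ _i : Fin 3, ε * (1 + a) * ‖B‖ := Finset.sum_le_sum (fun i _ => key i)
    _ = 3 * ε * (1 + a) * ‖B‖ := by
        simp only [Finset.sum_const, Finset.card_univ, Fintype.card_fin]
        ring

/-! ### The affine image `x ↦ q + A (x − p)` -/

/-- support: the affine map `x ↦ q + A (x − p)` (`A` a continuous linear automorphism of `ℝ³`) carrying an
ideal cell at `p` to a DISTORTED cell at `q`. -/
def affMap (p q : E3) (A : E3 ≃L[ℝ] E3) : E3 → E3 := fun x => q + A (x - p)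

/-- `affMap p q A x − q = A (x − p)`. -/
theorem affMap_sub (p q : E3) (A : E3 ≃L[ℝ] E3) (x : E3) : affMap p q A x - q = A (x - p) := by
  simp [affMap]

/-- `affMap` is continuous. -/
theorem continuous_affMap (p q : E3) (A : E3 ≃L[ℝ] E3) : Continuous (affMap p q A) :=
  continuous_const.add (A.continuous.comp (continuous_id.sub continuous_const))

/-- `affMap` has derivative `A` everywhere. -/
theorem hasFDerivAt_affMap (p q : E3) (A : E3 ≃L[ℝ] E3) (x : E3) :
    HasFDerivAt (affMap p q A) (A : E3 →L[ℝ] E3) x := by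
  have h1 : HasFDerivAt (fun x : E3 => x - p) (ContinuousLinearMap.id ℝ E3) x :=
    (hasFDerivAt_id x).sub_const p
  have h2 := (A : E3 →L[ℝ] E3).hasFDerivAt.comp x h1
  rw [ContinuousLinearMap.comp_id] at h2
  exact h2.const_add q

/-- `affMap` is injective. -/
theorem injective_affMap (p q : E3) (A : E3 ≃L[ℝ] E3) : Function.Injective (affMap p q A) := by
  intro x y hxy
  have h : A (x - p) = A (y - p) := add_left_cancel hxy
  exact sub_left_injective (A.injective h)

/-- Change of variables onto the distorted cell: `∫_{affMap '' K} g = |det A| · ∫_K g ∘ affMap`. -/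
theorem setIntegral_image_affMap (p q : E3) (A : E3 ≃L[ℝ] E3) {K : Set E3} (hK : MeasurableSet K)
    {F : Type*} [NormedAddCommGroup F] [NormedSpace ℝ F] (g : E3 → F) :
    ∫ y in affMap p q A '' K, g y
      = |(A : E3 →L[ℝ] E3).det| • ∫ x in K, g (affMap p q A x) := by
  rw [integral_image_eq_integral_abs_det_fderiv_smul volume hK
    (fun x _ => (hasFDerivAt_affMap p q A x).hasFDerivWithinAt) (injective_affMap p q A).injOn g,
    integral_smul]

/-- Volume of the distorted cell: `|affMap '' K| = |det A| · |K|` (in `toReal` form). -/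
theorem volume_image_affMap_toReal (p q : E3) (A : E3 ≃L[ℝ] E3) {K : Set E3} (hK : MeasurableSet K) :
    (volume (affMap p q A '' K)).toReal = |(A : E3 →L[ℝ] E3).det| * (volume K).toReal := by
  have h := setIntegral_image_affMap p q A hK (fun _ => (1 : ℝ))
  rw [setIntegral_const, setIntegral_const] at h
  simp only [smul_eq_mul, mul_one, measureReal_def] at h
  exact h

/-- The distorted cell is star-shaped about its centre. -/
theorem starConvex_image_affMap {K : Set E3} {p : E3} (hKs : StarConvex ℝ p K) (q : E3)
    (A : E3 ≃L[ℝ] E3) : StarConvex ℝ q (affMap p q A '' K) := by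
  rintro _ ⟨x, hx, rfl⟩ a b ha hb hab
  refine ⟨a • p + b • x, hKs hx ha hb hab, ?_⟩
  simp only [affMap]
  have h1 : a • p + b • x - p = b • (x - p) := by
    calc a • p + b • x - p = a • p + b • x - (a + b) • p := by rw [hab, one_smul]
      _ = b • (x - p) := by rw [add_smul, smul_sub]; abel
  rw [h1, map_smul]
  calc q + b • A (x - p) = (a + b) • q + b • A (x - p) := by rw [hab, one_smul]
    _ = a • q + b • (q + A (x - p)) := by rw [add_smul, smul_add]; abel

/-- Pointwise bound `‖A v‖^k ≤ a^k ‖v‖^k` from `‖A‖ ≤ a`. -/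
theorem norm_map_pow_le (A : E3 ≃L[ℝ] E3) {a : ℝ} (ha : ‖(A : E3 →L[ℝ] E3)‖ ≤ a) (v : E3) (k : ℕ) :
    ‖A v‖ ^ k ≤ a ^ k * ‖v‖ ^ k := by
  have h : ‖A v‖ ≤ a * ‖v‖ :=
    calc ‖A v‖ = ‖(A : E3 →L[ℝ] E3) v‖ := rfl
      _ ≤ ‖(A : E3 →L[ℝ] E3)‖ * ‖v‖ := ContinuousLinearMap.le_opNorm _ _
      _ ≤ a * ‖v‖ := mul_le_mul_of_nonneg_right ha (norm_nonneg _)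
  calc ‖A v‖ ^ k ≤ (a * ‖v‖) ^ k := pow_le_pow_left₀ (norm_nonneg _) h k
    _ = a ^ k * ‖v‖ ^ k := mul_pow _ _ _

/-- Absolute moments of the distorted cell. -/
theorem moment_image_affMap_le {K : Set E3} {p : E3} (hKc : IsCompact K) (q : E3) (A : E3 ≃L[ℝ] E3)
    {a μ : ℝ} (ha : ‖(A : E3 →L[ℝ] E3)‖ ≤ a) (k : ℕ)
    (hμ : (∫ x in K, ‖x - p‖ ^ k) ≤ μ * (volume K).toReal) :
    (∫ y in affMap p q A '' K, ‖y - q‖ ^ k) ≤ μ * a ^ k * (volume (affMap p q A '' K)).toReal := by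
  have hKm : MeasurableSet K := hKc.measurableSet
  rw [setIntegral_image_affMap p q A hKm, volume_image_affMap_toReal p q A hKm]
  simp only [affMap_sub, smul_eq_mul]
  have hd0 : 0 ≤ |(A : E3 →L[ℝ] E3).det| := abs_nonneg _
  have hsubc : Continuous fun x : E3 => x - p := continuous_id.sub continuous_const
  have i1 : IntegrableOn (fun x : E3 => ‖A (x - p)‖ ^ k) K :=
    ((A.continuous.comp hsubc).norm.pow k).continuousOn.integrableOn_compact hKc
  have i2 : IntegrableOn (fun x : E3 => a ^ k * ‖x - p‖ ^ k) K :=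
    (continuous_const.mul (hsubc.norm.pow k)).continuousOn.integrableOn_compact hKc
  have hmono : (∫ x in K, ‖A (x - p)‖ ^ k) ≤ ∫ x in K, a ^ k * ‖x - p‖ ^ k :=
    setIntegral_mono i1 i2 (fun x => norm_map_pow_le A ha (x - p) k)
  rw [integral_const_mul] at hmono
  have hak : 0 ≤ a ^ k := pow_nonneg (le_trans (norm_nonneg _) ha) k
  calc |(A : E3 →L[ℝ] E3).det| * ∫ x in K, ‖A (x - p)‖ ^ k
      ≤ |(A : E3 →L[ℝ] E3).det| * (a ^ k * (μ * (volume K).toReal)) :=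
        mul_le_mul_of_nonneg_left (hmono.trans (mul_le_mul_of_nonneg_left hμ hak)) hd0
    _ = μ * a ^ k * (|(A : E3 →L[ℝ] E3).det| * (volume K).toReal) := by ring

/-- **Distorted cells.**  If `K` is a moment cell at `p` with constants `(σ, δ, μ₃, μ₄)` and `A` is a linear
automorphism with `‖A − R‖ ≤ ε` for some linear isometry `R` and `‖A‖ ≤ a`, then the affine image
`q + A(K − p)` is a moment cell at `q` with constants `(σ, δa² + 3|σ|ε(1+a), μ₃a³, μ₄a⁴)` — the second
moment per volume `σ` is unchanged to first order, the isotropy defect grows by `3|σ|ε(1+a)`. -/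
theorem IsMomentCell.image_affMap {K : Set E3} {p : E3} {σ δ μ₃ μ₄ : ℝ}
    (hK : IsMomentCell K p σ δ μ₃ μ₄) (q : E3) (A : E3 ≃L[ℝ] E3) (R : E3 ≃ₗᵢ[ℝ] E3) {ε a : ℝ}
    (hε : ‖(A : E3 →L[ℝ] E3) - R.toLinearIsometry.toContinuousLinearMap‖ ≤ ε)
    (ha : ‖(A : E3 →L[ℝ] E3)‖ ≤ a) :
    IsMomentCell (affMap p q A '' K) q σ (δ * a ^ 2 + 3 * |σ| * ε * (1 + a)) (μ₃ * a ^ 3)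
      (μ₄ * a ^ 4) := by
  obtain ⟨hKc, hKs, hpK, hδ, hM1, hM2, hM3, hM4⟩ := hK
  have hKm : MeasurableSet K := hKc.measurableSet
  have hεnn : 0 ≤ ε := le_trans (norm_nonneg _) hε
  have hann : 0 ≤ a := le_trans (norm_nonneg _) ha
  set d : ℝ := |(A : E3 →L[ℝ] E3).det| with hd
  have hd0 : 0 ≤ d := abs_nonneg _
  set vol := (volume K).toReal with hvolK
  have hvol0 : 0 ≤ vol := ENNReal.toReal_nonneg
  have hvol : (volume (affMap p q A '' K)).toReal = d * vol := volume_image_affMap_toReal p q A hKm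
  refine ⟨hKc.image (continuous_affMap p q A), starConvex_image_affMap hKs q A,
    ⟨p, hpK, by simp [affMap]⟩, by positivity, ?_, ?_, ?_, ?_⟩
  · rw [setIntegral_image_affMap p q A hKm]
    simp only [affMap_sub]
    rw [A.integral_comp_comm (fun x : E3 => x - p), hM1, map_zero, smul_zero]
  · intro B
    set L : E3 →L[ℝ] E3 := (A : E3 →L[ℝ] E3) with hL
    set B' : E3 [×2]→L[ℝ] ℝ := B.compContinuousLinearMap (fun _ => L) with hB'
    have hB'ap : ∀ m : Fin 2 → E3, B' m = B (fun i => A (m i)) := fun m => by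
      simp [hB', hL, ContinuousMultilinearMap.compContinuousLinearMap_apply]
    have hnB' : ‖B'‖ ≤ ‖B‖ * a ^ 2 :=
      calc ‖B'‖ ≤ ‖B‖ * ∏ _i : Fin 2, ‖L‖ := B.norm_compContinuousLinearMap_le _
        _ = ‖B‖ * ‖L‖ ^ 2 := by simp
        _ ≤ ‖B‖ * a ^ 2 :=
            mul_le_mul_of_nonneg_left (pow_le_pow_left₀ (norm_nonneg _) ha 2) (norm_nonneg _)
    rw [setIntegral_image_affMap p q A hKm, hvol]
    simp only [affMap_sub]
    have e1 : (fun x : E3 => B (fun _ => A (x - p))) = fun x => B' (fun _ => x - p) := by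
      funext x; rw [hB'ap]
    rw [e1, smul_eq_mul]
    set I' := ∫ x in K, B' (fun _ => x - p) with hI'
    set T := ∑ i : Fin 3, B (fun _ => e3 i) with hT
    set T' := ∑ i : Fin 3, B' (fun _ => e3 i) with hT'
    have hform : |I' - σ * vol * T'| ≤ δ * vol * ‖B'‖ := hM2 B'
    have htr : |T' - T| ≤ 3 * ε * (1 + a) * ‖B‖ := by
      have e2 : T' = ∑ i : Fin 3, B (fun _ => L (e3 i)) := by
        rw [hT']; refine Finset.sum_congr rfl (fun i _ => ?_); rw [hB'ap]; rfl
      rw [e2, hT]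
      exact abs_sum_two_form_sub_le B L R hε ha
    have eq : d * I' - σ * (d * vol) * T = d * ((I' - σ * vol * T') + σ * vol * (T' - T)) := by ring
    rw [eq, abs_mul, abs_of_nonneg hd0]
    have step : |(I' - σ * vol * T') + σ * vol * (T' - T)|
        ≤ δ * vol * (‖B‖ * a ^ 2) + |σ| * vol * (3 * ε * (1 + a) * ‖B‖) := by
      calc _ ≤ |I' - σ * vol * T'| + |σ * vol * (T' - T)| := abs_add_le _ _
        _ ≤ δ * vol * ‖B'‖ + |σ| * vol * |T' - T| := by
            rw [abs_mul, abs_mul, abs_of_nonneg hvol0]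
            exact add_le_add hform le_rfl
        _ ≤ δ * vol * (‖B‖ * a ^ 2) + |σ| * vol * (3 * ε * (1 + a) * ‖B‖) :=
            add_le_add (mul_le_mul_of_nonneg_left hnB' (mul_nonneg hδ hvol0))
              (mul_le_mul_of_nonneg_left htr (mul_nonneg (abs_nonneg _) hvol0))
    calc d * |(I' - σ * vol * T') + σ * vol * (T' - T)|
        ≤ d * (δ * vol * (‖B‖ * a ^ 2) + |σ| * vol * (3 * ε * (1 + a) * ‖B‖)) :=
          mul_le_mul_of_nonneg_left step hd0
      _ = (δ * a ^ 2 + 3 * |σ| * ε * (1 + a)) * (d * vol) * ‖B‖ := by ring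
  · have h := moment_image_affMap_le hKc q A ha 3 hM3
    simpa [mul_comm, mul_assoc, mul_left_comm] using h
  · have h := moment_image_affMap_le hKc q A ha 4 hM4
    simpa [mul_comm, mul_assoc, mul_left_comm] using h

/-- Central symmetry is preserved by affine images. -/
theorem IsCentrallySymmetric.image_affMap {K : Set E3} {p : E3} (hS : IsCentrallySymmetric K p)
    (q : E3) (A : E3 ≃L[ℝ] E3) : IsCentrallySymmetric (affMap p q A '' K) q := by
  rintro _ ⟨x, hx, rfl⟩
  refine ⟨(2 : ℝ) • p - x, hS x hx, ?_⟩
  simp only [affMap]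
  have h1 : (2 : ℝ) • p - x - p = -(x - p) := by
    simp only [two_smul]; abel
  rw [h1, map_neg, two_smul]
  abel

/-- The structured cubic clause under affine images: `τ ↦ τ a³`. -/
theorem cubic_clause_image_affMap {K : Set E3} {p : E3} (hKc : IsCompact K) {τ : ℝ}
    (hτ : ∀ B : E3 [×3]→L[ℝ] ℝ, |∫ x in K, B (fun _ => x - p)| ≤ τ * (volume K).toReal * ‖B‖)
    (hτ0 : 0 ≤ τ) (q : E3) (A : E3 ≃L[ℝ] E3) {a : ℝ} (ha : ‖(A : E3 →L[ℝ] E3)‖ ≤ a)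
    (B : E3 [×3]→L[ℝ] ℝ) :
    |∫ y in affMap p q A '' K, B (fun _ => y - q)|
      ≤ τ * a ^ 3 * (volume (affMap p q A '' K)).toReal * ‖B‖ := by
  have hKm : MeasurableSet K := hKc.measurableSet
  set L : E3 →L[ℝ] E3 := (A : E3 →L[ℝ] E3) with hL
  set B' : E3 [×3]→L[ℝ] ℝ := B.compContinuousLinearMap (fun _ => L) with hB'
  have hB'ap : ∀ m : Fin 3 → E3, B' m = B (fun i => A (m i)) := fun m => by
    simp [hB', hL, ContinuousMultilinearMap.compContinuousLinearMap_apply]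
  have hnB' : ‖B'‖ ≤ ‖B‖ * a ^ 3 :=
    calc ‖B'‖ ≤ ‖B‖ * ∏ _i : Fin 3, ‖L‖ := B.norm_compContinuousLinearMap_le _
      _ = ‖B‖ * ‖L‖ ^ 3 := by simp
      _ ≤ ‖B‖ * a ^ 3 :=
          mul_le_mul_of_nonneg_left (pow_le_pow_left₀ (norm_nonneg _) ha 3) (norm_nonneg _)
  have hd0 : 0 ≤ |(A : E3 →L[ℝ] E3).det| := abs_nonneg _
  rw [setIntegral_image_affMap p q A hKm, volume_image_affMap_toReal p q A hKm]
  simp only [affMap_sub]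
  have e1 : (fun x : E3 => B (fun _ => A (x - p))) = fun x => B' (fun _ => x - p) := by
    funext x; rw [hB'ap]
  rw [e1, smul_eq_mul, abs_mul, abs_of_nonneg hd0]
  have hv0 : 0 ≤ τ * (volume K).toReal := mul_nonneg hτ0 ENNReal.toReal_nonneg
  calc |(A : E3 →L[ℝ] E3).det| * |∫ x in K, B' (fun _ => x - p)|
      ≤ |(A : E3 →L[ℝ] E3).det| * (τ * (volume K).toReal * (‖B‖ * a ^ 3)) :=
        mul_le_mul_of_nonneg_left ((hτ B').trans (mul_le_mul_of_nonneg_left hnB' hv0)) hd0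
    _ = τ * a ^ 3 * (|(A : E3 →L[ℝ] E3).det| * (volume K).toReal) * ‖B‖ := by ring

end

end Summit.AtomisticToContinuum.Crystallization.Theorems.OverbindingBudgetAffineFarFieldCellAffine
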